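import Mathlib
import Summits.PneNP.PneNP.Theorems.ConvexRankGatesConvexGateBlindRowsExtraction
import Summits.PneNP.PneNP.Theorems.ConvexRankGatesConvexGateBlindRowsCore

/-!
# PneNP / ConvexRankGates — `ConvexGateBlind`: row lower bound, the double count

Helpers (`--supports stmt-PneNP-10680`) for `ConvexRankGatesConvexGateBlindRows.lean`.
Setting: non-negative weightings `W₁, …, W_p` of the pairs of `Fin m` such that for every `k`-set `S`
and every `(c'+1)`-colouring `h` some row is HANDLED, i.e. gives the complete multipartite graph of
`h` less weight than the pairs inside `S` (this is what a CONV gate computing CLIQUE provides, by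
monotonicity of feasibility in the right-hand side). Count LABELLED CONFIGURATIONS
`(a, b, σ, c₀, τ, hout)`: an ordered pair, an injection `σ` of `k-2` further vertices, a colour `c₀`
for `a, b`, an injection `τ` of further colours for `σ` (so `S = {a,b} ∪ σ` is rainbow except
`{a,b}`), and free colours `hout` elsewhere (`rows_pattern`).
* `rows_fiber`: in a fibre `(a, b, σ, c₀, τ)` whose pair `{a,b}` is NOT among the `r₁` top pairs of
  the row, at most a `(c'+1)^{-g}` fraction of the `hout` is handled (heavy outside pairs are
  monochromatic, `g` private ones pin `g` colours);
* `rows_count`: hence `(c'+1)^g · m(m-1) ≤ p · (2 r₁ (c'+1)^g + m(m-1))` with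
  `r₁ = k² + 2(g+k)g`.
-/

namespace Summit.PneNP.PneNP.Theorems

open Finset

/-! ### The fibre bound and the pattern of a labelled configuration -/

section rows

open scoped Classical

/-- **Fibre bound.** Fix a non-negative weighting `W`, a vertex set `S ∋ a, b` (`a ≠ b`, `#S ≤ k`)
and a partial pattern `pat` forcing the colours on `S` so that every pair inside `S` other than
`{a,b}` is bichromatic whatever the free colours are. If at least `r₁ ≥ k² + 2(g+k)g` non-loop pairs
`f ≠ {a,b}` have `W {a,b} ≤ W f`, then at most `c^(m-g)` free colourings `hout` are HANDLED by `W`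
(bichromatic weight `<` weight inside `S`): `2(g+k)g` of the heavy pairs lie outside `S`, `g` private
ones among them are monochromatic (`mono_of_handled`), which pins `g` free colours
(`card_colorings_agree_le`). [folklore] -/
theorem rows_fiber {m c g k r₁ : ℕ} (W : Sym2 (Fin m) → ℝ) (hW : ∀ e, 0 ≤ W e)
    (S : Finset (Fin m)) (a b : Fin m) (hab : a ≠ b) (ha : a ∈ S) (hb : b ∈ S) (hSk : S.card ≤ k)
    (pat : Fin m → Option (Fin c)) (hpatS : ∀ v, v ∉ S → pat v = none)
    (hrain : ∀ hout : Fin m → Fin c, ∀ v ∈ S, ∀ v' ∈ S, v ≠ v' → s(v, v') ≠ s(a, b) →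
      (pat v).getD (hout v) ≠ (pat v').getD (hout v'))
    (hr : k ^ 2 + 2 * (g + k) * g ≤ r₁)
    (htop : r₁ ≤ ((univ.filter fun f : Sym2 (Fin m) => ¬ f.IsDiag).filter
      fun f => f ≠ s(a, b) ∧ W s(a, b) ≤ W f).card) :
    (univ.filter fun hout : Fin m → Fin c =>
      (∑ e ∈ univ.filter (fun e : Sym2 (Fin m) => ¬ e.IsDiag),
          (if (e.map (fun v => (pat v).getD (hout v))).IsDiag then 0 else W e)) <
        ∑ e ∈ univ.filter (fun e : Sym2 (Fin m) => ¬ e.IsDiag),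
          (if (∀ v ∈ e, v ∈ S) then W e else 0)).card ≤ c ^ (m - g) := by
  -- the heavy pairs not inside `S`
  set F := univ.filter fun f : Sym2 (Fin m) =>
    f ≠ s(a, b) ∧ ¬ f.IsDiag ∧ W s(a, b) ≤ W f ∧ ¬ (∀ v ∈ f, v ∈ S) with hF
  have hFnd : ∀ f ∈ F, ¬ f.IsDiag := fun f hf => (Finset.mem_filter.1 hf).2.2.1
  have hFout : ∀ f ∈ F, ∃ v ∈ f, v ∉ S := by
    intro f hf
    have := (Finset.mem_filter.1 hf).2.2.2.2
    push Not at this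
    exact this
  have hinside : (univ.filter fun f : Sym2 (Fin m) => ¬ f.IsDiag ∧ ∀ v ∈ f, v ∈ S).card ≤ k ^ 2 := by
    calc (univ.filter fun f : Sym2 (Fin m) => ¬ f.IsDiag ∧ ∀ v ∈ f, v ∈ S).card
        ≤ ((S ×ˢ S).image fun q : Fin m × Fin m => s(q.1, q.2)).card := by
          refine Finset.card_le_card fun f hf => ?_
          have hfS := (Finset.mem_filter.1 hf).2.2
          induction f using Sym2.ind with
          | _ v v' => exact Finset.mem_image.2 ⟨(v, v'), Finset.mem_product.2
              ⟨hfS v (Sym2.mem_mk_left _ _), hfS v' (Sym2.mem_mk_right _ _)⟩, rfl⟩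
      _ ≤ (S ×ˢ S).card := Finset.card_image_le
      _ = S.card * S.card := Finset.card_product _ _
      _ ≤ k * k := Nat.mul_le_mul hSk hSk
      _ = k ^ 2 := (sq k).symm
  have hFcard : 2 * (g + S.card) * g ≤ F.card := by
    have hcov : ((univ.filter fun f : Sym2 (Fin m) => ¬ f.IsDiag).filter
        fun f => f ≠ s(a, b) ∧ W s(a, b) ≤ W f) ⊆
        F ∪ (univ.filter fun f : Sym2 (Fin m) => ¬ f.IsDiag ∧ ∀ v ∈ f, v ∈ S) := by
      intro f hf
      rw [Finset.mem_filter, Finset.mem_filter] at hf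
      obtain ⟨⟨-, h2⟩, h1, h3⟩ := hf
      by_cases h4 : ∀ v ∈ f, v ∈ S
      · exact Finset.mem_union_right _ (Finset.mem_filter.2 ⟨Finset.mem_univ _, h2, h4⟩)
      · exact Finset.mem_union_left _ (Finset.mem_filter.2 ⟨Finset.mem_univ _, h1, h2, h3, h4⟩)
    have := (htop.trans (Finset.card_le_card hcov)).trans (Finset.card_union_le _ _)
    have h2 : 2 * (g + S.card) * g ≤ 2 * (g + k) * g :=
      Nat.mul_le_mul_right _ (Nat.mul_le_mul_left _ (by omega))
    omega
  obtain ⟨u, x, hu, huS, hux, hpriv, hne⟩ := private_edges_of_card_le S F hFnd hFout hFcard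
  -- handled colourings make all private pairs monochromatic
  refine le_trans (Finset.card_le_card fun hout hh => ?_)
    (card_colorings_agree_le pat u x hu (fun j => hpatS _ (huS j))
      (fun j l => by
        by_cases hjl : j = l
        · subst hjl
          exact hne j
        · exact hpriv j l hjl))
  have hlt := (Finset.mem_filter.1 hh).2
  refine Finset.mem_filter.2 ⟨Finset.mem_univ _, fun j => ?_⟩
  have hfj := (Finset.mem_filter.1 (hux j)).2
  have := mono_of_handled W hW S (fun v => (pat v).getD (hout v)) a b hab ha hb (hrain hout) hlt
    s(u j, x j) hfj.2.1 hfj.2.2.2 hfj.2.2.1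
  rwa [sym2_map_mk_isDiag_iff] at this

/-- Ordered pairs over a set of unordered pairs: at most two per pair. [folklore] -/
theorem card_offDiag_filter_mem_le {m : ℕ} (T : Finset (Sym2 (Fin m))) :
    ((univ : Finset (Fin m)).offDiag.filter fun ab => s(ab.1, ab.2) ∈ T).card ≤ 2 * T.card := by
  have hcov : ((univ : Finset (Fin m)).offDiag.filter fun ab => s(ab.1, ab.2) ∈ T) ⊆
      T.biUnion fun e => (univ : Finset (Fin m)).offDiag.filter fun ab => s(ab.1, ab.2) = e := by
    intro ab hab
    rw [Finset.mem_filter] at hab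
    exact Finset.mem_biUnion.2 ⟨_, hab.2, Finset.mem_filter.2 ⟨hab.1, rfl⟩⟩
  refine (Finset.card_le_card hcov).trans ((Finset.card_biUnion_le).trans ?_)
  rw [mul_comm, ← smul_eq_mul, ← Finset.sum_const]
  refine Finset.sum_le_sum fun e _ => ?_
  induction e using Sym2.ind with
  | _ v v' =>
    calc ((univ : Finset (Fin m)).offDiag.filter fun ab => s(ab.1, ab.2) = s(v, v')).card
        ≤ ({(v, v'), (v', v)} : Finset (Fin m × Fin m)).card := by
          refine Finset.card_le_card fun ab hab => ?_
          have h := (Finset.mem_filter.1 hab).2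
          rw [Sym2.eq_iff] at h
          rcases h with ⟨h1, h2⟩ | ⟨h1, h2⟩
          · rw [Finset.mem_insert]
            exact Or.inl (Prod.ext h1 h2)
          · rw [Finset.mem_insert, Finset.mem_singleton]
            exact Or.inr (Prod.ext h1 h2)
      _ ≤ 2 := Finset.card_le_two

/-- **The labelled pattern.** Data: an ordered pair `a ≠ b`, an injection `σ` of `k-2` further
vertices, a colour `c₀` and an injection `τ` of `k-2` further colours (read through `c₀.succAbove`).
The vertex set `S = {a, b} ∪ σ` has `k` elements and the partial pattern (colour `c₀` on `a, b`,
colour `c₀.succAbove (τ j)` on `σ j`, free elsewhere) is free off `S` and makes every pair inside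
`S` other than `{a,b}` bichromatic. [folklore] -/
theorem rows_pattern {m k c' : ℕ} (hk : 2 ≤ k) (a b : Fin m) (hab : a ≠ b)
    (σ : Fin (k - 2) ↪ {v : Fin m // v ≠ a ∧ v ≠ b}) (c₀ : Fin (c' + 1)) (τ : Fin (k - 2) ↪ Fin c') :
    let S : Finset (Fin m) := insert a (insert b (univ.image fun j => (σ j).1))
    let pat : Fin m → Option (Fin (c' + 1)) := fun v => if v = a ∨ v = b then some c₀ else
      (Function.partialInv (fun j => (σ j).1) v).map fun j => c₀.succAbove (τ j)
    S.card = k ∧ a ∈ S ∧ b ∈ S ∧ (∀ v, v ∉ S → pat v = none) ∧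
      (∀ hout : Fin m → Fin (c' + 1), ∀ v ∈ S, ∀ v' ∈ S, v ≠ v' → s(v, v') ≠ s(a, b) →
        (pat v).getD (hout v) ≠ (pat v').getD (hout v')) := by
  intro S pat
  have hσinj : Function.Injective fun j => (σ j).1 := fun j l h => σ.injective (Subtype.ext h)
  have hpi := hσinj.isPartialInv
  -- membership in `S`
  have hmemS : ∀ v, v ∈ S ↔ v = a ∨ v = b ∨ ∃ j, (σ j).1 = v := by
    intro v
    simp only [S, Finset.mem_insert, Finset.mem_image, Finset.mem_univ, true_and]
  -- values of the pattern
  have hpat_a : pat a = some c₀ := by simp [pat]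
  have hpat_b : pat b = some c₀ := by simp [pat]
  have hpat_σ : ∀ j, pat (σ j).1 = some (c₀.succAbove (τ j)) := by
    intro j
    have h1 : ¬ ((σ j).1 = a ∨ (σ j).1 = b) := fun h => h.elim (σ j).2.1 (σ j).2.2
    simp only [pat, if_neg h1]
    rw [Function.partialInv_left hσinj]
    rfl
  have hpat_out : ∀ v, v ∉ S → pat v = none := by
    intro v hv
    rw [hmemS] at hv
    push Not at hv
    obtain ⟨hva, hvb, hvσ⟩ := hv
    have h1 : ¬ (v = a ∨ v = b) := fun h => h.elim hva hvb
    simp only [pat, if_neg h1]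
    cases hp : Function.partialInv (fun j => (σ j).1) v with
    | none => rfl
    | some j => exact absurd ((hpi j v).1 hp) (hvσ j)
  refine ⟨?_, (hmemS a).2 (Or.inl rfl), (hmemS b).2 (Or.inr (Or.inl rfl)), hpat_out, ?_⟩
  · -- cardinality
    have hσa : a ∉ insert b (univ.image fun j => (σ j).1) := by
      simp only [Finset.mem_insert, Finset.mem_image, Finset.mem_univ, true_and, not_or]
      exact ⟨hab, fun ⟨j, hj⟩ => (σ j).2.1 hj⟩
    have hσb : b ∉ (univ.image fun j => (σ j).1) := by
      simp only [Finset.mem_image, Finset.mem_univ, true_and]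
      exact fun ⟨j, hj⟩ => (σ j).2.2 hj
    show (insert a (insert b (univ.image fun j => (σ j).1))).card = k
    rw [Finset.card_insert_of_notMem hσa, Finset.card_insert_of_notMem hσb,
      Finset.card_image_of_injective _ hσinj, Finset.card_univ, Fintype.card_fin]
    omega
  · -- rainbow off `{a, b}`
    intro hout v hv v' hv' hvv' hne
    rw [hmemS] at hv hv'
    have key : ∀ w w' : Fin m, (w = a ∨ w = b ∨ ∃ j, (σ j).1 = w) → (w' = a ∨ w' = b ∨ ∃ j, (σ j).1 = w') →
        w ≠ w' → s(w, w') ≠ s(a, b) → (pat w).getD (hout w) = (pat w').getD (hout w') → False := by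
      intro w w' hw hw' hww' hne' heq
      rcases hw with rfl | rfl | ⟨j, rfl⟩ <;> rcases hw' with rfl | rfl | ⟨l, rfl⟩
      · exact hww' rfl
      · exact hne' rfl
      · rw [hpat_a, hpat_σ] at heq
        exact (Fin.succAbove_ne c₀ (τ l)) heq.symm
      · exact hne' Sym2.eq_swap
      · exact hww' rfl
      · rw [hpat_b, hpat_σ] at heq
        exact (Fin.succAbove_ne c₀ (τ l)) heq.symm
      · rw [hpat_a, hpat_σ] at heq
        exact (Fin.succAbove_ne c₀ (τ j)) heq
      · rw [hpat_b, hpat_σ] at heq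
        exact (Fin.succAbove_ne c₀ (τ j)) heq
      · rw [hpat_σ, hpat_σ] at heq
        simp only [Option.getD_some] at heq
        have := τ.injective (Fin.succAbove_right_injective heq)
        exact hww' (by rw [this])
    exact fun heq => key v v' hv hv' hvv' hne heq

/-- **Double counting.** Let `W₁, …, W_p ≥ 0` weight the pairs of `Fin m` and suppose that for every
`k`-set `S` and every `(c'+1)`-colouring `h` some row is HANDLED (bichromatic weight `<` weight
inside `S`). Count labelled configurations `(a, b, σ, c₀, τ, hout)` (ordered pair, `k-2` further
vertices, their rainbow pattern, free colours): all are handled by some row; a row handles the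
configurations whose pair `{a,b}` is among its `≤ r₁` top pairs (`card_topSet_le`; at most `2r₁`
ordered pairs) and at most a `(c'+1)^{-g}` fraction of every other fibre (`rows_fiber`). Hence
`(c'+1)^g · m(m-1) ≤ p · (2 r₁ (c'+1)^g + m(m-1))`. [folklore] -/
theorem rows_count {m k c' g r₁ p : ℕ} (hk : 2 ≤ k) (hkm : k ≤ m) (hkc : k - 2 ≤ c') (hgm : g ≤ m)
    (W : Fin p → Sym2 (Fin m) → ℝ) (hW : ∀ i e, 0 ≤ W i e) (hr : k ^ 2 + 2 * (g + k) * g ≤ r₁)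
    (hsep : ∀ S : Finset (Fin m), S.card = k → ∀ h : Fin m → Fin (c' + 1),
      ∃ i, (∑ e ∈ univ.filter (fun e : Sym2 (Fin m) => ¬ e.IsDiag),
              (if (e.map h).IsDiag then 0 else W i e)) <
           ∑ e ∈ univ.filter (fun e : Sym2 (Fin m) => ¬ e.IsDiag),
              (if (∀ v ∈ e, v ∈ S) then W i e else 0)) :
    (c' + 1) ^ g * (univ : Finset (Fin m)).offDiag.card ≤
      p * (2 * r₁ * (c' + 1) ^ g + (univ : Finset (Fin m)).offDiag.card) := by
  set c := c' + 1 with hc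
  set Ed := univ.filter (fun e : Sym2 (Fin m) => ¬ e.IsDiag) with hEd
  set OD := (univ : Finset (Fin m)).offDiag with hOD
  -- the handled predicate, the vertex set and the pattern of a configuration
  let HD : (Sym2 (Fin m) → ℝ) → Finset (Fin m) → (Fin m → Fin c) → Prop := fun w S h =>
    (∑ e ∈ Ed, (if (e.map h).IsDiag then 0 else w e)) <
      ∑ e ∈ Ed, (if (∀ v ∈ e, v ∈ S) then w e else 0)
  let Sof : (a b : Fin m) → (Fin (k - 2) ↪ {v : Fin m // v ≠ a ∧ v ≠ b}) → Finset (Fin m) :=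
    fun a b σ => insert a (insert b (univ.image fun j => (σ j).1))
  let patof : (a b : Fin m) → (Fin (k - 2) ↪ {v : Fin m // v ≠ a ∧ v ≠ b}) → Fin c →
      (Fin (k - 2) ↪ Fin c') → Fin m → Option (Fin c) :=
    fun a b σ c₀ τ v => if v = a ∨ v = b then some c₀ else
      (Function.partialInv (fun j => (σ j).1) v).map fun j => c₀.succAbove (τ j)
  let n : Fin p → (a b : Fin m) → ℕ := fun i a b =>
    (univ.filter fun φ : (Fin (k - 2) ↪ {v : Fin m // v ≠ a ∧ v ≠ b}) ×
        (Fin c × (Fin (k - 2) ↪ Fin c')) × (Fin m → Fin c) =>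
      HD (W i) (Sof a b φ.1) (fun v => (patof a b φ.1 φ.2.1.1 φ.2.1.2 v).getD (φ.2.2 v))).card
  let Φ₀ : ℕ := (m - 2).descFactorial (k - 2) * (c * c'.descFactorial (k - 2) * c ^ m)
  let T : Fin p → Finset (Sym2 (Fin m)) := fun i =>
    Ed.filter fun e => (Ed.filter fun f => f ≠ e ∧ W i e ≤ W i f).card < r₁
  have hT : ∀ i, (T i).card ≤ r₁ := fun i => card_topSet_le Ed (W i) r₁
  -- (0) every fibre has `Φ₀` elements, `Φ₀ > 0`
  have hcardΦ : ∀ a b : Fin m, a ≠ b →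
      Fintype.card ((Fin (k - 2) ↪ {v : Fin m // v ≠ a ∧ v ≠ b}) ×
        (Fin c × (Fin (k - 2) ↪ Fin c')) × (Fin m → Fin c)) = Φ₀ := by
    intro a b hab
    have hV : Fintype.card {v : Fin m // v ≠ a ∧ v ≠ b} = m - 2 := by
      rw [Fintype.card_subtype]
      have : (univ.filter fun v : Fin m => v ≠ a ∧ v ≠ b) = (univ.erase a).erase b := by
        ext v
        simp only [Finset.mem_filter, Finset.mem_univ, true_and, Finset.mem_erase]
        tauto
      rw [this, Finset.card_erase_of_mem (Finset.mem_erase.2 ⟨hab.symm, Finset.mem_univ _⟩),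
        Finset.card_erase_of_mem (Finset.mem_univ _), Finset.card_univ, Fintype.card_fin]
      omega
    simp only [Fintype.card_prod, Fintype.card_embedding_eq, Fintype.card_fun, Fintype.card_fin,
      hV, Φ₀]
  have hΦ₀ : 0 < Φ₀ := by
    have h1 : 0 < (m - 2).descFactorial (k - 2) :=
      Nat.pos_of_ne_zero fun h => by rw [Nat.descFactorial_eq_zero_iff_lt] at h; omega
    have h2 : 0 < c'.descFactorial (k - 2) :=
      Nat.pos_of_ne_zero fun h => by rw [Nat.descFactorial_eq_zero_iff_lt] at h; omega
    have h3 : 0 < c ^ m := pow_pos (by omega) m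
    positivity
  -- (1) every configuration is handled by some row
  have h1 : ∀ a b : Fin m, a ≠ b → Φ₀ ≤ ∑ i, n i a b := by
    intro a b hab
    rw [← hcardΦ a b hab, ← Finset.card_univ]
    have hcov : (univ : Finset ((Fin (k - 2) ↪ {v : Fin m // v ≠ a ∧ v ≠ b}) ×
        (Fin c × (Fin (k - 2) ↪ Fin c')) × (Fin m → Fin c))) ⊆
        (univ : Finset (Fin p)).biUnion fun i => univ.filter fun φ =>
          HD (W i) (Sof a b φ.1) (fun v => (patof a b φ.1 φ.2.1.1 φ.2.1.2 v).getD (φ.2.2 v)) := by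
      intro φ _
      obtain ⟨hS, -, -, -, -⟩ := rows_pattern hk a b hab φ.1 φ.2.1.1 φ.2.1.2
      obtain ⟨i, hi⟩ := hsep (Sof a b φ.1) hS
        (fun v => (patof a b φ.1 φ.2.1.1 φ.2.1.2 v).getD (φ.2.2 v))
      exact Finset.mem_biUnion.2 ⟨i, Finset.mem_univ _, Finset.mem_filter.2 ⟨Finset.mem_univ _, hi⟩⟩
    exact (Finset.card_le_card hcov).trans Finset.card_biUnion_le
  -- (2) off its top set a row handles at most a `c^{-g}` fraction of a fibre
  have h2 : ∀ i (a b : Fin m), a ≠ b → s(a, b) ∉ T i → n i a b * c ^ g ≤ Φ₀ := by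
    intro i a b hab htop
    have hr₁ : r₁ ≤ (Ed.filter fun f => f ≠ s(a, b) ∧ W i s(a, b) ≤ W i f).card := by
      have hab' : s(a, b) ∈ Ed :=
        Finset.mem_filter.2 ⟨Finset.mem_univ _, by rw [Sym2.mk_isDiag_iff]; exact hab⟩
      by_contra hlt
      push Not at hlt
      exact htop (Finset.mem_filter.2 ⟨hab', hlt⟩)
    have hfib : ∀ (σ : Fin (k - 2) ↪ {v : Fin m // v ≠ a ∧ v ≠ b}) (c₀ : Fin c)
        (τ : Fin (k - 2) ↪ Fin c'),
        (univ.filter fun hout : Fin m → Fin c =>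
          HD (W i) (Sof a b σ) (fun v => (patof a b σ c₀ τ v).getD (hout v))).card ≤ c ^ (m - g) := by
      intro σ c₀ τ
      obtain ⟨hS, ha, hb, hout, hrain⟩ := rows_pattern hk a b hab σ c₀ τ
      exact rows_fiber (W i) (hW i) (Sof a b σ) a b hab ha hb hS.le (patof a b σ c₀ τ) hout hrain
        hr hr₁
    have hn : n i a b ≤ Fintype.card (Fin (k - 2) ↪ {v : Fin m // v ≠ a ∧ v ≠ b}) *
        (Fintype.card (Fin c × (Fin (k - 2) ↪ Fin c')) * c ^ (m - g)) := by
      show (univ.filter _).card ≤ _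
      rw [Finset.card_filter, Fintype.sum_prod_type]
      refine (Finset.sum_le_sum (g := fun _ => Fintype.card (Fin c × (Fin (k - 2) ↪ Fin c')) *
        c ^ (m - g)) fun σ _ => ?_).trans (by rw [Finset.sum_const, Finset.card_univ, smul_eq_mul])
      rw [Fintype.sum_prod_type]
      refine (Finset.sum_le_sum (g := fun _ => c ^ (m - g)) fun pt _ => ?_).trans
        (by rw [Finset.sum_const, Finset.card_univ, smul_eq_mul])
      rw [← Finset.card_filter]
      exact hfib σ pt.1 pt.2
    calc n i a b * c ^ g
        ≤ Fintype.card (Fin (k - 2) ↪ {v : Fin m // v ≠ a ∧ v ≠ b}) *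
            (Fintype.card (Fin c × (Fin (k - 2) ↪ Fin c')) * c ^ (m - g)) * c ^ g :=
          Nat.mul_le_mul_right _ hn
      _ = Φ₀ := by
          rw [← hcardΦ a b hab]
          simp only [Fintype.card_prod, Fintype.card_fun, Fintype.card_fin]
          rw [show c ^ m = c ^ (m - g) * c ^ g by rw [← pow_add, Nat.sub_add_cancel hgm]]
          ring
  -- (3) the trivial bound
  have h3 : ∀ i (a b : Fin m), a ≠ b → n i a b ≤ Φ₀ := by
    intro i a b hab
    rw [← hcardΦ a b hab]
    exact Finset.card_filter_le _ _
  -- (4) per row, summed over ordered pairs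
  have hODmem : ∀ ab ∈ OD, (ab : Fin m × Fin m).1 ≠ ab.2 := fun ab hab => (Finset.mem_offDiag.1 hab).2.2
  have h4 : ∀ i, c ^ g * ∑ ab ∈ OD, n i ab.1 ab.2 ≤ c ^ g * Φ₀ * (2 * r₁) + Φ₀ * OD.card := by
    intro i
    rw [Finset.mul_sum, ← Finset.sum_filter_add_sum_filter_not OD (fun ab => s(ab.1, ab.2) ∈ T i)]
    refine Nat.add_le_add ?_ ?_
    · calc ∑ ab ∈ OD.filter (fun ab => s(ab.1, ab.2) ∈ T i), c ^ g * n i ab.1 ab.2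
          ≤ ∑ ab ∈ OD.filter (fun ab => s(ab.1, ab.2) ∈ T i), c ^ g * Φ₀ :=
            Finset.sum_le_sum fun ab hab =>
              Nat.mul_le_mul_left _ (h3 i _ _ (hODmem ab (Finset.mem_filter.1 hab).1))
        _ = (OD.filter fun ab => s(ab.1, ab.2) ∈ T i).card * (c ^ g * Φ₀) := by
            rw [Finset.sum_const, smul_eq_mul]
        _ ≤ (2 * (T i).card) * (c ^ g * Φ₀) :=
            Nat.mul_le_mul_right _ (card_offDiag_filter_mem_le (T i))
        _ ≤ (2 * r₁) * (c ^ g * Φ₀) := Nat.mul_le_mul_right _ (Nat.mul_le_mul_left _ (hT i))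
        _ = c ^ g * Φ₀ * (2 * r₁) := by ring
    · calc ∑ ab ∈ OD.filter (fun ab => ¬ s(ab.1, ab.2) ∈ T i), c ^ g * n i ab.1 ab.2
          ≤ ∑ ab ∈ OD.filter (fun ab => ¬ s(ab.1, ab.2) ∈ T i), Φ₀ :=
            Finset.sum_le_sum fun ab hab => by
              rw [mul_comm]
              exact h2 i _ _ (hODmem ab (Finset.mem_filter.1 hab).1) (Finset.mem_filter.1 hab).2
        _ = (OD.filter fun ab => ¬ s(ab.1, ab.2) ∈ T i).card * Φ₀ := by
            rw [Finset.sum_const, smul_eq_mul]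
        _ ≤ OD.card * Φ₀ := Nat.mul_le_mul_right _ (Finset.card_filter_le _ _)
        _ = Φ₀ * OD.card := mul_comm _ _
  -- (5) assemble and cancel `Φ₀`
  have h5 : c ^ g * (OD.card * Φ₀) ≤ p * (c ^ g * Φ₀ * (2 * r₁) + Φ₀ * OD.card) := by
    calc c ^ g * (OD.card * Φ₀) = c ^ g * ∑ ab ∈ OD, Φ₀ := by rw [Finset.sum_const, smul_eq_mul]
      _ ≤ c ^ g * ∑ ab ∈ OD, ∑ i, n i ab.1 ab.2 :=
          Nat.mul_le_mul_left _ (Finset.sum_le_sum fun ab hab => h1 _ _ (hODmem ab hab))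
      _ = ∑ i, c ^ g * ∑ ab ∈ OD, n i ab.1 ab.2 := by rw [Finset.sum_comm, Finset.mul_sum]
      _ ≤ ∑ _i : Fin p, (c ^ g * Φ₀ * (2 * r₁) + Φ₀ * OD.card) := Finset.sum_le_sum fun i _ => h4 i
      _ = p * (c ^ g * Φ₀ * (2 * r₁) + Φ₀ * OD.card) := by
          rw [Finset.sum_const, Finset.card_univ, Fintype.card_fin, smul_eq_mul]
  have h6 : Φ₀ * (c ^ g * OD.card) ≤ Φ₀ * (p * (2 * r₁ * c ^ g + OD.card)) := by
    calc Φ₀ * (c ^ g * OD.card) = c ^ g * (OD.card * Φ₀) := by ring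
      _ ≤ p * (c ^ g * Φ₀ * (2 * r₁) + Φ₀ * OD.card) := h5
      _ = Φ₀ * (p * (2 * r₁ * c ^ g + OD.card)) := by ring
  exact Nat.le_of_mul_le_mul_left h6 hΦ₀

end rows

end Summit.PneNP.PneNP.Theorems
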